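import Literature.MathematicalPhysics.QuantumLattice.HubbardSpinReflectionSignRule
import Literature.MathematicalPhysics.QuantumLattice.FermionOperatorsEtaSu2Proofs
import HarnessLib

/-!
# The half-filled repulsive Hubbard ground state is a pseudospin (`η`) singlet; the staggered
# on-site pair sum rule

Ladder R1–R4 with certified numbers; no claim on H/H₀.

On a connected bipartite graph `G` on `Λ = A ⊔ B` with `|A| = |B|`, hopping `t ≠ 0` and `U > 0`,
THE half-filled ground state `ψ` of `hamiltonian G t U` (unique by Lieb's theorem) satisfies

  `η_ε ψ = 0` and `η†_ε ψ = 0`,   `η†_ε = Σ_x ε_x c†_{x↑} c†_{x↓}` (Yang's `η`-pair creator,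
  `ε_x = ±1` alternating along the bonds),

i.e. it is a singlet of Yang–Zhang's pseudospin `SU(2)` (`etaLower_mulVec_eq_zero_of_groundState`,
`etaRaise_mulVec_eq_zero_of_groundState`).

**Mechanism (a Lean proof, not the Shiba-transformation argument of the literature).**
`P = η†_ε η_ε` commutes with `H` on a bipartite-signed graph (`[H, η†_ε] = U η†_ε` and its adjoint,
`hamiltonian_mul_etaRaise_mul_etaLower`) and preserves the particle number, so `P ψ` lies in the
half-filled ground sector, which is one-dimensional (Lieb): `P ψ = c ψ`.  By Lieb's structure
theorem (`LiebTwo.exists_posDef_coefficient_of_groundState`) `ψ = c' Φ(W₀)` with `W₀` positive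
definite, so the amplitude of `ψ` on the Néel configuration `A↑ ∪ B↓` is a diagonal entry of `W₀`
times signs, hence non-zero (`groundState_apply_pairSet_compl_ne_zero`) — while `η†_ε` only produces
configurations with a doubly occupied site, so `(P ψ)(A↑ ∪ B↓) = 0`.  Therefore `c = 0`,
`⟨ψ, η† η ψ⟩ = ‖η ψ‖² = 0`, and `η ψ = 0`; `η† ψ = 0` follows from `[η, η†] = |Λ| - N̂` at half
filling.

**Consequences for pair–pair correlations (the sum rules, benchmark vocabulary).**  With the
on-site (s-wave) pair `Δ_y = c_{y↓} c_{y↑}`, `Δ†_x = c†_{x↑} c†_{x↓}` and `Δ†_x Δ_x = n_{x↑} n_{x↓}`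
(`pairCreation_mul_pairAnnihilation_self`):
* the staggered on-site pair structure factor vanishes identically,
  `⟨ψ, η†_ε η_ε ψ⟩ = Σ_{x,y} ε_x ε_y ⟨ψ, Δ†_x Δ_y ψ⟩ = 0` (`expect_etaRaise_mul_etaLower_eq_zero`);
* row by row, `Σ_y ε_y ⟨ψ, Δ†_x Δ_y ψ⟩ = 0` for every site `x`
  (`sum_stagger_mul_expect_pair_eq_zero`), hence the OFF-SITE staggered pair correlation of every
  site equals minus its double occupancy,
  `Σ_{y ≠ x} ε_x ε_y ⟨ψ, Δ†_x Δ_y ψ⟩ = -⟨ψ, n_{x↑} n_{x↓} ψ⟩`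
  (`offsite_stagger_pair_sum_eq_neg_doubleOcc`), and summed over `x`,
  `Σ_x Σ_{y ≠ x} ε_x ε_y ⟨ψ, Δ†_x Δ_y ψ⟩ = -⟨ψ, D̂ ψ⟩`, `D̂ = Σ_x n_{x↑} n_{x↓}`
  (`offsite_stagger_pair_sum_eq_neg_expect_doubleOcc`) — so every certified two-sided bracket on
  the double occupancy `d = ⟨D̂⟩/|Λ|` is a certified two-sided bracket on this pair–pair sum;
* the even square torus `(ℤ/Lℤ)²`, `ε = torusStagger`: `hubbardTorus_eta_mulVec_eq_zero`,
  `hubbardTorus_offsite_stagger_pair_sum_eq_neg_expect_doubleOcc`.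

Everything is a proved theorem; no named fact, no `sorry`.

## References
* E. H. Lieb, *Two theorems on the Hubbard model*, Phys. Rev. Lett. 62 (1989) 1201, Theorems 1–2
  and the proof of Theorem 2 (uniqueness; the positive-definite coefficient matrix).
  [cite: LiebPRL1989, proof of Theorem 2]
* C. N. Yang, *η pairing and off-diagonal long-range order in a Hubbard model*, Phys. Rev. Lett. 63
  (1989) 2144, eqs. (4), (6) (`η`, `[H, η†]`). [cite: Yang1989, eq. (6)]
* C. N. Yang, S. C. Zhang, *SO₄ symmetry in a Hubbard model*, Mod. Phys. Lett. B 4 (1990) 759,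
  Theorems 1 and 4 (pseudospin `SU(2)`; the partial particle–hole map exchanging spin and
  pseudospin). [cite: YangZhang1990, Theorem 1]
* S. C. Zhang, *Constraints on s-wave pairing in the Hubbard model*, Phys. Rev. B 42 (1990) 1012
  (pseudospin constraints on on-site pair correlations). [cite: ZhangPRB1990]
* F. H. L. Essler, H. Frahm, F. Göhmann, A. Klümper, V. E. Korepin, *The one-dimensional Hubbard
  model*, CUP 2005, §2.2 eqs. (2.80)–(2.87) (the `η`-pairing symmetry via the Shiba transformation).
  [cite: EsslerEtAl2005, §2.2]
-/

noncomputable section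

namespace Literature.MathematicalPhysics.QuantumLattice

open Matrix Finset LiebThm1 LiebTwo
open scoped ComplexOrder

section General

variable {Λ : Type*} [LinearOrder Λ] [Fintype Λ]

/-! ### §1 Operator algebra of the `η` pair -/

/-- `η†_ε` creates a doubly occupied site: `(η†_ε φ)(s) = 0` whenever `s` has none.
[cite: Yang1989, eq. (4)] -/
theorem etaRaise_mulVec_apply_eq_zero_of_forall_not (ε : Λ → ℤˣ) (φ : Fock (Orb Λ))
    {s : Finset (Orb Λ)} (hs : ∀ x, ¬ (orb x 0 ∈ s ∧ orb x 1 ∈ s)) :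
    (etaRaise ε *ᵥ φ) s = 0 := by
  rw [etaRaise, Matrix.sum_mulVec, Finset.sum_apply]
  refine Finset.sum_eq_zero fun x _ => ?_
  rw [Matrix.smul_mulVec, Pi.smul_apply, EtaPairingODLRO.pairCreation_mulVec_apply, if_neg (hs x),
    smul_zero]

/-- The spin-only configuration `α↑ ∪ αᶜ↓` has no doubly occupied site. [cite: LiebPRL1989, proof of Theorem 2] -/
theorem not_orb_mem_pairSet_compl_and (α : Finset Λ) (x : Λ) :
    ¬ (orb x 0 ∈ pairSet α αᶜ ∧ orb x 1 ∈ pairSet α αᶜ) := by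
  rw [orb_zero_mem_pairSet, orb_one_mem_pairSet, Finset.mem_compl]
  exact fun h => h.2 h.1

/-- **`Δ†_x Δ_x = n_{x↑} n_{x↓}`**: `c†_{x↑} c†_{x↓} c_{x↓} c_{x↑} = n_{x↑} n_{x↓}` (twice the CAR between
the two orbitals of the site `x`). [cite: Yang1989, eq. (4)] -/
theorem pairCreation_mul_pairAnnihilation_self (x : Λ) :
    creation (orb x 0) * creation (orb x 1) * (annihilation (orb x 1) * annihilation (orb x 0)) =
      (numberOp x 0 * numberOp x 1 : Matrix (Finset (Orb Λ)) (Finset (Orb Λ)) ℂ) := by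
  have hne : orb x (0 : Fin 2) ≠ orb x 1 := fun h => absurd (orb_eq_orb_iff.1 h).2 (by decide)
  have h1 : annihilation (orb x (0 : Fin 2)) * creation (orb x 1) =
      -(creation (orb x 1) * annihilation (orb x (0 : Fin 2))) := by
    have h := annihilation_mul_creation_add_creation_mul_annihilation_holds (orb x (0 : Fin 2)) (orb x 1)
    rw [if_neg hne] at h
    exact eq_neg_of_add_eq_zero_left h
  have h2 : annihilation (orb x (0 : Fin 2)) * annihilation (orb x 1) =
      -(annihilation (orb x 1) * annihilation (orb x (0 : Fin 2))) :=
    eq_neg_of_add_eq_zero_left (annihilation_anticommute_holds (orb x (0 : Fin 2)) (orb x 1))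
  symm
  unfold numberOp
  calc creation (orb x 0) * annihilation (orb x 0) * (creation (orb x 1) * annihilation (orb x 1))
      = creation (orb x 0) * (annihilation (orb x 0) * creation (orb x 1)) * annihilation (orb x 1) := by
        simp only [Matrix.mul_assoc]
    _ = -(creation (orb x 0) * creation (orb x 1) * (annihilation (orb x 0) * annihilation (orb x 1))) := by
        rw [h1]; simp only [Matrix.mul_neg, Matrix.neg_mul, Matrix.mul_assoc]
    _ = creation (orb x 0) * creation (orb x 1) * (annihilation (orb x 1) * annihilation (orb x 0)) := by
        rw [h2, Matrix.mul_neg, neg_neg]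

/-- `η†_ε η_ε = Σ_{x,y} ε_x ε_y Δ†_x Δ_y` as a double sum of on-site pair words. [cite: Yang1989, eq. (4)] -/
theorem etaRaise_mul_etaLower_eq_sum (ε : Λ → ℤˣ) :
    etaRaise ε * etaLower ε = ∑ x, ∑ y, (((ε x : ℤ) : ℂ) * ((ε y : ℤ) : ℂ)) •
      (creation (orb x 0) * creation (orb x 1) * (annihilation (orb y 1) * annihilation (orb y 0))) := by
  rw [etaRaise, EtaPairingODLRO.etaLower_eq_sum', Finset.sum_mul_sum]
  refine Finset.sum_congr rfl fun x _ => Finset.sum_congr rfl fun y _ => ?_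
  rw [smul_mul_assoc, mul_smul_comm, smul_smul]

/-- `η_ε` lowers the particle number by two. [cite: Yang1989, eq. (4)] -/
theorem isNParticle_etaLower_mulVec (ε : Λ → ℤˣ) {N : ℕ} {φ : Fock (Orb Λ)} (hφ : IsNParticle N φ) :
    IsNParticle (N - 1 - 1) (etaLower ε *ᵥ φ) := by
  rw [EtaPairingODLRO.etaLower_eq_sum', Matrix.sum_mulVec]
  refine (mem_nParticleSubmodule_iff _ _).1 (Submodule.sum_mem _ fun y _ => ?_)
  rw [Matrix.smul_mulVec, ← mulVec_mulVec]
  exact Submodule.smul_mem _ _ ((mem_nParticleSubmodule_iff _ _).2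
    (PosSemidefTrace.isNParticle_annihilation_mulVec
      (PosSemidefTrace.isNParticle_annihilation_mulVec hφ _) _))

/-- `η†_ε` raises the particle number by two. [cite: Yang1989, eq. (4)] -/
theorem isNParticle_etaRaise_mulVec (ε : Λ → ℤˣ) {N : ℕ} {φ : Fock (Orb Λ)} (hφ : IsNParticle N φ) :
    IsNParticle (N + 1 + 1) (etaRaise ε *ᵥ φ) := by
  rw [etaRaise, Matrix.sum_mulVec]
  refine (mem_nParticleSubmodule_iff _ _).1 (Submodule.sum_mem _ fun x _ => ?_)
  rw [Matrix.smul_mulVec, ← mulVec_mulVec]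
  exact Submodule.smul_mem _ _ ((mem_nParticleSubmodule_iff _ _).2
    (IsNParticle.creation_mulVec_holds (IsNParticle.creation_mulVec_holds hφ _) _))

variable {G : SimpleGraph Λ} [DecidableRel G.Adj]

/-- **`[H, η†_ε η_ε] = 0`** on a bipartite-signed graph (`ε_x = -ε_y` along every bond): from Yang's
`[H, η†_ε] = U η†_ε` and its adjoint `[H, η_ε] = -U η_ε`. [cite: Yang1989, eq. (6)]
[cite: EsslerEtAl2005, §2.2] -/
theorem hamiltonian_mul_etaRaise_mul_etaLower (ε : Λ → ℤˣ) (hε : ∀ x y : Λ, G.Adj x y → ε x = -ε y)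
    (t U : ℝ) :
    hamiltonian G t U * (etaRaise ε * etaLower ε) = etaRaise ε * etaLower ε * hamiltonian G t U := by
  have h1 : hamiltonian G t U * etaRaise ε = etaRaise ε * hamiltonian G t U + (U : ℂ) • etaRaise ε := by
    rw [← hamiltonian_commutator_etaRaise G ε hε t U]; abel
  have hH : (hamiltonian G t U)ᴴ = hamiltonian G t U := (LiebThm1.hamiltonian_isHermitian G t U).eq
  have h2 : etaLower ε * hamiltonian G t U = hamiltonian G t U * etaLower ε + (U : ℂ) • etaLower ε := by
    have h := congrArg conjTranspose h1
    rw [conjTranspose_mul, conjTranspose_add, conjTranspose_mul, conjTranspose_smul, hH,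
      Complex.star_def, Complex.conj_ofReal, show (etaRaise ε)ᴴ = etaLower ε from rfl] at h
    exact h
  have h3 : hamiltonian G t U * etaLower ε = etaLower ε * hamiltonian G t U - (U : ℂ) • etaLower ε :=
    eq_sub_of_add_eq h2.symm
  calc hamiltonian G t U * (etaRaise ε * etaLower ε)
      = (etaRaise ε * hamiltonian G t U + (U : ℂ) • etaRaise ε) * etaLower ε := by rw [← mul_assoc, h1]
    _ = etaRaise ε * (hamiltonian G t U * etaLower ε) + (U : ℂ) • (etaRaise ε * etaLower ε) := by
        rw [add_mul, mul_assoc, smul_mul_assoc]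
    _ = etaRaise ε * etaLower ε * hamiltonian G t U := by
        rw [h3, mul_sub, mul_smul_comm, sub_add_cancel, mul_assoc]

/-! ### §2 The Néel amplitude and the pseudospin singlet -/

/-- **Every spin-only configuration carries weight in THE half-filled ground state**: on a connected
bipartite graph with `|A| = |B|`, `t ≠ 0`, `U > 0`, a half-filled ground state `ψ ≠ 0` has
`ψ(α↑ ∪ αᶜ↓) ≠ 0` for every `α` with `|α| = |A|` — its amplitude there is a diagonal entry of Lieb's
positive-definite coefficient matrix `W₀` times signs. [cite: LiebPRL1989, proof of Theorem 2] -/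
theorem groundState_apply_pairSet_compl_ne_zero (hG : G.Connected) (A : Finset Λ)
    (hA : ∀ x y : Λ, G.Adj x y → (x ∈ A ↔ y ∉ A)) (hcard : Aᶜ.card = A.card)
    {t U : ℝ} (ht : t ≠ 0) (hU : 0 < U) {ψ : Fock (Orb Λ)} (hψ0 : ψ ≠ 0)
    (hN : IsNParticle (Fintype.card Λ) ψ)
    (hHψ : hamiltonian G t U *ᵥ ψ = ((groundEnergyAt G t U (Fintype.card Λ) : ℝ) : ℂ) • ψ)
    {α : Finset Λ} (hα : α.card = A.card) : ψ (pairSet α αᶜ) ≠ 0 := by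
  classical
  obtain ⟨W₀, hW₀, c, rfl⟩ := exists_posDef_coefficient_of_groundState hG A hA hcard ht hU hN hHψ
  have hc : c ≠ 0 := by
    rintro rfl
    exact hψ0 (zero_smul _ _)
  have hdiag : extMatrix A.card W₀ α αᶜᶜ = W₀ ⟨α, hα⟩ ⟨α, hα⟩ := by
    rw [compl_compl]
    exact extMatrix_apply_coe A.card W₀ ⟨α, hα⟩ ⟨α, hα⟩
  rw [Pi.smul_apply, smul_eq_mul, toFockN, toFock_pairSet, hdiag, compl_compl]
  have h1 : pairSign α αᶜ ≠ 0 := fun h => by simpa [h] using pairSign_mul_self α αᶜ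
  have h2 : kappaSign A α ≠ 0 := fun h => by simpa [h] using kappaSign_mul_self A α
  exact mul_ne_zero hc (mul_ne_zero (mul_ne_zero h1 h2) (hW₀.diag_pos (i := ⟨α, hα⟩)).ne')

/-- **The half-filled repulsive ground state is annihilated by `η_ε`** (pseudospin lowest = highest
weight, i.e. a pseudospin singlet): connected bipartite graph, `|A| = |B|`, `t ≠ 0`, `U > 0`,
`ε` alternating along the bonds. [cite: LiebPRL1989, proof of Theorem 2] [cite: YangZhang1990, Theorem 1]
[cite: EsslerEtAl2005, §2.2] -/
theorem etaLower_mulVec_eq_zero_of_groundState (hG : G.Connected) (A : Finset Λ)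
    (hA : ∀ x y : Λ, G.Adj x y → (x ∈ A ↔ y ∉ A)) (hcard : Aᶜ.card = A.card)
    {t U : ℝ} (ht : t ≠ 0) (hU : 0 < U) (ε : Λ → ℤˣ) (hε : ∀ x y : Λ, G.Adj x y → ε x = -ε y)
    {ψ : Fock (Orb Λ)} (hN : IsNParticle (Fintype.card Λ) ψ)
    (hHψ : hamiltonian G t U *ᵥ ψ = ((groundEnergyAt G t U (Fintype.card Λ) : ℝ) : ℂ) • ψ) :
    etaLower ε *ᵥ ψ = 0 := by
  classical
  by_cases hψ0 : ψ = 0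
  · rw [hψ0, mulVec_zero]
  have hΛ : Fintype.card Λ = A.card + A.card := by
    rw [← Finset.card_add_card_compl A, hcard]
  rcases Nat.eq_zero_or_pos A.card with hA0 | hA0
  · -- degenerate case `Λ = ∅`: `η = 0`
    haveI : IsEmpty Λ := Fintype.card_eq_zero_iff.1 (by omega)
    rw [EtaPairingODLRO.etaLower_eq_sum', Finset.univ_eq_empty, Finset.sum_empty, zero_mulVec]
  set P : Matrix (Finset (Orb Λ)) (Finset (Orb Λ)) ℂ := etaRaise ε * etaLower ε with hP
  -- `P ψ` lies in the half-filled ground sector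
  have hPN : IsNParticle (Fintype.card Λ) (P *ᵥ ψ) := by
    have h := isNParticle_etaRaise_mulVec ε (isNParticle_etaLower_mulVec ε hN)
    rw [mulVec_mulVec] at h
    have hn : Fintype.card Λ - 1 - 1 + 1 + 1 = Fintype.card Λ := by omega
    rwa [hn] at h
  have hPH : hamiltonian G t U *ᵥ (P *ᵥ ψ) =
      ((groundEnergyAt G t U (Fintype.card Λ) : ℝ) : ℂ) • (P *ᵥ ψ) := by
    rw [mulVec_mulVec, hP, hamiltonian_mul_etaRaise_mul_etaLower ε hε t U, ← mulVec_mulVec, hHψ,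
      mulVec_smul]
  have hmem := (LiebHalfFilled.mem_groundSector_iff G t U _ ψ).2 ⟨hN, hHψ⟩
  have hPmem := (LiebHalfFilled.mem_groundSector_iff G t U _ (P *ᵥ ψ)).2 ⟨hPN, hPH⟩
  set V := (hamiltonian G t U).sectorGroundSpace (nParticleSubmodule (ι := Orb Λ) (Fintype.card Λ))
  have hv0 : (⟨ψ, hmem⟩ : V) ≠ 0 := fun h => hψ0 (congrArg Subtype.val h)
  obtain ⟨c, hc⟩ := (finrank_eq_one_iff_of_nonzero' (⟨ψ, hmem⟩ : V) hv0).1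
    (LiebHalfFilled.finrank_groundSector_eq_one hG A hA hcard ht hU).1 ⟨P *ᵥ ψ, hPmem⟩
  have hc' : c • ψ = P *ᵥ ψ := by simpa using congrArg Subtype.val hc
  -- evaluate at the Néel configuration `A↑ ∪ Aᶜ↓`
  have hs0 : ψ (pairSet A Aᶜ) ≠ 0 :=
    groundState_apply_pairSet_compl_ne_zero hG A hA hcard ht hU hψ0 hN hHψ rfl
  have hP0 : (P *ᵥ ψ) (pairSet A Aᶜ) = 0 := by
    rw [hP, ← mulVec_mulVec]
    exact etaRaise_mulVec_apply_eq_zero_of_forall_not ε _ (not_orb_mem_pairSet_compl_and A)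
  have hc0 : c = 0 := by
    have h := congrFun hc' (pairSet A Aᶜ)
    rw [Pi.smul_apply, smul_eq_mul, hP0] at h
    exact (mul_eq_zero.1 h).resolve_right hs0
  have hPψ : P *ᵥ ψ = 0 := by rw [← hc', hc0, zero_smul]
  -- `‖η ψ‖² = ⟨ψ, η† η ψ⟩ = 0`
  have hnorm : star (etaLower ε *ᵥ ψ) ⬝ᵥ (etaLower ε *ᵥ ψ) = 0 := by
    have h : star ψ ⬝ᵥ (P *ᵥ ψ) = 0 := by rw [hPψ, dotProduct_zero]
    rwa [hP, ← mulVec_mulVec, show etaRaise ε = (etaLower ε)ᴴ from (conjTranspose_conjTranspose _).symm,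
      dotProduct_mulVec, vecMul_conjTranspose, star_star] at h
  exact dotProduct_star_self_eq_zero.1 hnorm

/-- **The half-filled repulsive ground state is annihilated by `η†_ε`** as well (from `η ψ = 0` and
`[η, η†] = |Λ| - N̂`, which vanishes at half filling). [cite: LiebPRL1989, proof of Theorem 2]
[cite: YangZhang1990, Theorem 1] [cite: Yang1989, eq. (4)] -/
theorem etaRaise_mulVec_eq_zero_of_groundState (hG : G.Connected) (A : Finset Λ)
    (hA : ∀ x y : Λ, G.Adj x y → (x ∈ A ↔ y ∉ A)) (hcard : Aᶜ.card = A.card)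
    {t U : ℝ} (ht : t ≠ 0) (hU : 0 < U) (ε : Λ → ℤˣ) (hε : ∀ x y : Λ, G.Adj x y → ε x = -ε y)
    {ψ : Fock (Orb Λ)} (hN : IsNParticle (Fintype.card Λ) ψ)
    (hHψ : hamiltonian G t U *ᵥ ψ = ((groundEnergyAt G t U (Fintype.card Λ) : ℝ) : ℂ) • ψ) :
    etaRaise ε *ᵥ ψ = 0 := by
  have hη := etaLower_mulVec_eq_zero_of_groundState hG A hA hcard ht hU ε hε hN hHψ
  have h : etaLower ε *ᵥ (etaRaise ε *ᵥ ψ) = 0 := by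
    rw [EtaPairingODLRO.etaLower_mulVec_etaRaise_mulVec, hη, mulVec_zero, zero_add]
    funext s
    show ((Fintype.card Λ : ℂ) - s.card) * ψ s = 0
    by_cases hs : s.card = Fintype.card Λ
    · rw [hs, sub_self, zero_mul]
    · rw [hN s hs, mul_zero]
  have hnorm : star (etaRaise ε *ᵥ ψ) ⬝ᵥ (etaRaise ε *ᵥ ψ) = 0 := by
    have h' : star ψ ⬝ᵥ (etaLower ε *ᵥ (etaRaise ε *ᵥ ψ)) = 0 := by rw [h, dotProduct_zero]
    rwa [etaLower, dotProduct_mulVec, vecMul_conjTranspose, star_star] at h'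
  exact dotProduct_star_self_eq_zero.1 hnorm

/-! ### §3 The staggered on-site pair sum rules -/

/-- **The staggered on-site pair structure factor vanishes**: `⟨ψ, η†_ε η_ε ψ⟩ = 0` for THE
half-filled repulsive ground state. [cite: ZhangPRB1990] [cite: YangZhang1990, Theorem 1]
[cite: LiebPRL1989, proof of Theorem 2] -/
theorem expect_etaRaise_mul_etaLower_eq_zero (hG : G.Connected) (A : Finset Λ)
    (hA : ∀ x y : Λ, G.Adj x y → (x ∈ A ↔ y ∉ A)) (hcard : Aᶜ.card = A.card)
    {t U : ℝ} (ht : t ≠ 0) (hU : 0 < U) (ε : Λ → ℤˣ) (hε : ∀ x y : Λ, G.Adj x y → ε x = -ε y)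
    {ψ : Fock (Orb Λ)} (hN : IsNParticle (Fintype.card Λ) ψ)
    (hHψ : hamiltonian G t U *ᵥ ψ = ((groundEnergyAt G t U (Fintype.card Λ) : ℝ) : ℂ) • ψ) :
    expect (etaRaise ε * etaLower ε) ψ = 0 ∧ expect (etaLower ε * etaRaise ε) ψ = 0 := by
  constructor
  · show star ψ ⬝ᵥ ((etaRaise ε * etaLower ε) *ᵥ ψ) = 0
    rw [← mulVec_mulVec, etaLower_mulVec_eq_zero_of_groundState hG A hA hcard ht hU ε hε hN hHψ,
      mulVec_zero, dotProduct_zero]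
  · show star ψ ⬝ᵥ ((etaLower ε * etaRaise ε) *ᵥ ψ) = 0
    rw [← mulVec_mulVec, etaRaise_mulVec_eq_zero_of_groundState hG A hA hcard ht hU ε hε hN hHψ,
      mulVec_zero, dotProduct_zero]

/-- **Row sum rule**: for every site `x`, `Σ_y ε_y ⟨ψ, Δ†_x Δ_y ψ⟩ = 0`
(`Δ†_x = c†_{x↑} c†_{x↓}`, `Δ_y = c_{y↓} c_{y↑}`) in THE half-filled repulsive ground state.
[cite: ZhangPRB1990] [cite: LiebPRL1989, proof of Theorem 2] -/
theorem sum_stagger_mul_expect_pair_eq_zero (hG : G.Connected) (A : Finset Λ)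
    (hA : ∀ x y : Λ, G.Adj x y → (x ∈ A ↔ y ∉ A)) (hcard : Aᶜ.card = A.card)
    {t U : ℝ} (ht : t ≠ 0) (hU : 0 < U) (ε : Λ → ℤˣ) (hε : ∀ x y : Λ, G.Adj x y → ε x = -ε y)
    {ψ : Fock (Orb Λ)} (hN : IsNParticle (Fintype.card Λ) ψ)
    (hHψ : hamiltonian G t U *ᵥ ψ = ((groundEnergyAt G t U (Fintype.card Λ) : ℝ) : ℂ) • ψ) (x : Λ) :
    ∑ y, ((ε y : ℤ) : ℂ) * (star ψ ⬝ᵥ ((creation (orb x 0) * creation (orb x 1) *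
      (annihilation (orb y 1) * annihilation (orb y 0))) *ᵥ ψ)) = 0 := by
  calc ∑ y, ((ε y : ℤ) : ℂ) * (star ψ ⬝ᵥ ((creation (orb x 0) * creation (orb x 1) *
          (annihilation (orb y 1) * annihilation (orb y 0))) *ᵥ ψ))
      = star ψ ⬝ᵥ ((creation (orb x 0) * creation (orb x 1)) *ᵥ (etaLower ε *ᵥ ψ)) := by
        rw [EtaPairingODLRO.etaLower_eq_sum', sum_mulVec, mulVec_sum, dotProduct_sum]
        refine Finset.sum_congr rfl fun y _ => ?_
        rw [smul_mulVec, mulVec_smul, dotProduct_smul, smul_eq_mul, mulVec_mulVec]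
    _ = 0 := by
        rw [etaLower_mulVec_eq_zero_of_groundState hG A hA hcard ht hU ε hε hN hHψ, mulVec_zero,
          dotProduct_zero]

/-- **Off-site staggered pair correlation of a site = minus its double occupancy**:
`Σ_{y ≠ x} ε_x ε_y ⟨ψ, Δ†_x Δ_y ψ⟩ = -⟨ψ, n_{x↑} n_{x↓} ψ⟩` in THE half-filled repulsive ground state.
[cite: ZhangPRB1990] [cite: LiebPRL1989, proof of Theorem 2] -/
theorem offsite_stagger_pair_sum_eq_neg_doubleOcc (hG : G.Connected) (A : Finset Λ)
    (hA : ∀ x y : Λ, G.Adj x y → (x ∈ A ↔ y ∉ A)) (hcard : Aᶜ.card = A.card)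
    {t U : ℝ} (ht : t ≠ 0) (hU : 0 < U) (ε : Λ → ℤˣ) (hε : ∀ x y : Λ, G.Adj x y → ε x = -ε y)
    {ψ : Fock (Orb Λ)} (hN : IsNParticle (Fintype.card Λ) ψ)
    (hHψ : hamiltonian G t U *ᵥ ψ = ((groundEnergyAt G t U (Fintype.card Λ) : ℝ) : ℂ) • ψ) (x : Λ) :
    ∑ y ∈ univ.erase x, ((ε x : ℤ) : ℂ) * ((ε y : ℤ) : ℂ) *
        (star ψ ⬝ᵥ ((creation (orb x 0) * creation (orb x 1) *
          (annihilation (orb y 1) * annihilation (orb y 0))) *ᵥ ψ)) =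
      -(star ψ ⬝ᵥ ((numberOp x 0 * numberOp x 1) *ᵥ ψ)) := by
  have h := sum_stagger_mul_expect_pair_eq_zero hG A hA hcard ht hU ε hε hN hHψ x
  rw [← Finset.add_sum_erase _ _ (mem_univ x), pairCreation_mul_pairAnnihilation_self] at h
  have h' := eq_neg_of_add_eq_zero_right h
  have hx : ((ε x : ℤ) : ℂ) * ((ε x : ℤ) : ℂ) = 1 := by
    rw [← Int.cast_mul, ← Units.val_mul, Int.units_mul_self, Units.val_one, Int.cast_one]
  calc ∑ y ∈ univ.erase x, ((ε x : ℤ) : ℂ) * ((ε y : ℤ) : ℂ) *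
          (star ψ ⬝ᵥ ((creation (orb x 0) * creation (orb x 1) *
            (annihilation (orb y 1) * annihilation (orb y 0))) *ᵥ ψ))
      = ((ε x : ℤ) : ℂ) * ∑ y ∈ univ.erase x, ((ε y : ℤ) : ℂ) *
          (star ψ ⬝ᵥ ((creation (orb x 0) * creation (orb x 1) *
            (annihilation (orb y 1) * annihilation (orb y 0))) *ᵥ ψ)) := by
        rw [Finset.mul_sum]
        exact Finset.sum_congr rfl fun y _ => mul_assoc _ _ _
    _ = -(star ψ ⬝ᵥ ((numberOp x 0 * numberOp x 1) *ᵥ ψ)) := by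
        rw [h', mul_neg, ← mul_assoc, hx, one_mul]

/-- **The off-site staggered on-site-pair sum equals minus the double occupancy**:
`Σ_x Σ_{y ≠ x} ε_x ε_y ⟨ψ, Δ†_x Δ_y ψ⟩ = -⟨ψ, D̂ ψ⟩`, `D̂ = Σ_x n_{x↑} n_{x↓}`, in THE half-filled
repulsive ground state — every certified two-sided bracket on `d = ⟨D̂⟩/|Λ|` is one on this pair–pair
sum. [cite: ZhangPRB1990] [cite: LiebPRL1989, proof of Theorem 2] -/
theorem offsite_stagger_pair_sum_eq_neg_expect_doubleOcc (hG : G.Connected) (A : Finset Λ)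
    (hA : ∀ x y : Λ, G.Adj x y → (x ∈ A ↔ y ∉ A)) (hcard : Aᶜ.card = A.card)
    {t U : ℝ} (ht : t ≠ 0) (hU : 0 < U) (ε : Λ → ℤˣ) (hε : ∀ x y : Λ, G.Adj x y → ε x = -ε y)
    {ψ : Fock (Orb Λ)} (hN : IsNParticle (Fintype.card Λ) ψ)
    (hHψ : hamiltonian G t U *ᵥ ψ = ((groundEnergyAt G t U (Fintype.card Λ) : ℝ) : ℂ) • ψ) :
    ∑ x, ∑ y ∈ univ.erase x, ((ε x : ℤ) : ℂ) * ((ε y : ℤ) : ℂ) *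
        (star ψ ⬝ᵥ ((creation (orb x 0) * creation (orb x 1) *
          (annihilation (orb y 1) * annihilation (orb y 0))) *ᵥ ψ)) =
      -expect (∑ x, numberOp x 0 * numberOp x 1) ψ := by
  show _ = -(star ψ ⬝ᵥ ((∑ x, numberOp x 0 * numberOp x 1) *ᵥ ψ))
  rw [sum_mulVec, dotProduct_sum, ← Finset.sum_neg_distrib]
  exact Finset.sum_congr rfl fun x _ =>
    offsite_stagger_pair_sum_eq_neg_doubleOcc hG A hA hcard ht hU ε hε hN hHψ x

/-- `IsGroundState` form of the pseudospin-singlet property. [cite: LiebPRL1989, proof of Theorem 2]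
[cite: YangZhang1990, Theorem 1] -/
theorem eta_mulVec_eq_zero_of_isGroundState (hG : G.Connected) (A : Finset Λ)
    (hA : ∀ x y : Λ, G.Adj x y → (x ∈ A ↔ y ∉ A)) (hcard : Aᶜ.card = A.card)
    {t U : ℝ} (ht : t ≠ 0) (hU : 0 < U) (ε : Λ → ℤˣ) (hε : ∀ x y : Λ, G.Adj x y → ε x = -ε y)
    {ψ : Fock (Orb Λ)} (hψ : IsGroundState (hamiltonian G t U) (Fintype.card Λ) ψ) :
    etaLower ε *ᵥ ψ = 0 ∧ etaRaise ε *ᵥ ψ = 0 :=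
  ⟨etaLower_mulVec_eq_zero_of_groundState hG A hA hcard ht hU ε hε hψ.1 hψ.2.2,
    etaRaise_mulVec_eq_zero_of_groundState hG A hA hcard ht hU ε hε hψ.1 hψ.2.2⟩

/-- `IsGroundState` form of the off-site staggered pair sum rule. [cite: ZhangPRB1990]
[cite: LiebPRL1989, proof of Theorem 2] -/
theorem offsite_stagger_pair_sum_eq_neg_expect_doubleOcc_of_isGroundState (hG : G.Connected)
    (A : Finset Λ) (hA : ∀ x y : Λ, G.Adj x y → (x ∈ A ↔ y ∉ A)) (hcard : Aᶜ.card = A.card)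
    {t U : ℝ} (ht : t ≠ 0) (hU : 0 < U) (ε : Λ → ℤˣ) (hε : ∀ x y : Λ, G.Adj x y → ε x = -ε y)
    {ψ : Fock (Orb Λ)} (hψ : IsGroundState (hamiltonian G t U) (Fintype.card Λ) ψ) :
    ∑ x, ∑ y ∈ univ.erase x, ((ε x : ℤ) : ℂ) * ((ε y : ℤ) : ℂ) *
        expect (creation (orb x 0) * creation (orb x 1) *
          (annihilation (orb y 1) * annihilation (orb y 0))) ψ =
      -expect (∑ x, numberOp x 0 * numberOp x 1) ψ :=
  offsite_stagger_pair_sum_eq_neg_expect_doubleOcc hG A hA hcard ht hU ε hε hψ.1 hψ.2.2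

end General

/-! ### §4 The even square torus `(ℤ/Lℤ)²` with `ε = torusStagger` -/

section Torus

variable {L : ℕ} [NeZero L]

omit [NeZero L] in
/-- `|(ℤ/Lℤ)²| = L²` for the fermion torus. [folklore] -/
private theorem card_fermionTorus_sq' : Fintype.card (FermionTorus 2 L) = L ^ 2 := by
  simp only [FermionTorus, Fintype.card_lex, Fintype.card_fun, Fintype.card_fin]

/-- **Pseudospin singlet on the even square torus**: every half-filled ground state of
`hamiltonian (fermionTorusGraph 2 L) t U` (`L` even, `t ≠ 0`, `U > 0`) satisfies `η ψ = η† ψ = 0`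
with Yang's staggering `ε_x = (-1)^{x₁+x₂}`. [cite: LiebPRL1989, proof of Theorem 2]
[cite: YangZhang1990, Theorem 1] [cite: Yang1989, eq. (4)] -/
theorem hubbardTorus_eta_mulVec_eq_zero (hL : Even L) {t U : ℝ} (ht : t ≠ 0) (hU : 0 < U)
    {ψ : Fock (Orb (FermionTorus 2 L))} (hN : IsNParticle (L ^ 2) ψ)
    (hHψ : hamiltonian (fermionTorusGraph 2 L) t U *ᵥ ψ =
      ((groundEnergyAt (fermionTorusGraph 2 L) t U (L ^ 2) : ℝ) : ℂ) • ψ) :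
    etaLower (torusStagger (d := 2) (L := L)) *ᵥ ψ = 0 ∧
      etaRaise (torusStagger (d := 2) (L := L)) *ᵥ ψ = 0 := by
  obtain ⟨hG, hA, h2, -⟩ := LiebHalfFilled.hubbardTorus_lieb_hypotheses (L := L) hL
  have hcard := LiebHalfFilled.compl_card_eq_card_of_two_mul h2
  have hε : ∀ x y : FermionTorus 2 L, (fermionTorusGraph 2 L).Adj x y →
      torusStagger x = -torusStagger y := fun x y h => torusStagger_eq_neg_of_adj_holds hL h
  rw [← card_fermionTorus_sq'] at hN hHψ
  exact ⟨etaLower_mulVec_eq_zero_of_groundState hG _ hA hcard ht hU _ hε hN hHψ,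
    etaRaise_mulVec_eq_zero_of_groundState hG _ hA hcard ht hU _ hε hN hHψ⟩

/-- **The off-site staggered on-site-pair sum on the even square torus equals `-⟨D̂⟩`**:
`Σ_x Σ_{y ≠ x} (-1)^{x+y} ⟨ψ, c†_{x↑} c†_{x↓} c_{y↓} c_{y↑} ψ⟩ = -⟨ψ, Σ_x n_{x↑} n_{x↓} ψ⟩` for every
half-filled ground state (`L` even, `t ≠ 0`, `U > 0`). [cite: ZhangPRB1990]
[cite: LiebPRL1989, proof of Theorem 2] -/
theorem hubbardTorus_offsite_stagger_pair_sum_eq_neg_expect_doubleOcc (hL : Even L) {t U : ℝ}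
    (ht : t ≠ 0) (hU : 0 < U) {ψ : Fock (Orb (FermionTorus 2 L))} (hN : IsNParticle (L ^ 2) ψ)
    (hHψ : hamiltonian (fermionTorusGraph 2 L) t U *ᵥ ψ =
      ((groundEnergyAt (fermionTorusGraph 2 L) t U (L ^ 2) : ℝ) : ℂ) • ψ) :
    ∑ x : FermionTorus 2 L, ∑ y ∈ univ.erase x,
        ((torusStagger x : ℤ) : ℂ) * ((torusStagger y : ℤ) : ℂ) *
          expect (creation (orb x 0) * creation (orb x 1) *
            (annihilation (orb y 1) * annihilation (orb y 0))) ψ =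
      -expect (∑ x : FermionTorus 2 L, numberOp x 0 * numberOp x 1) ψ := by
  obtain ⟨hG, hA, h2, -⟩ := LiebHalfFilled.hubbardTorus_lieb_hypotheses (L := L) hL
  have hcard := LiebHalfFilled.compl_card_eq_card_of_two_mul h2
  have hε : ∀ x y : FermionTorus 2 L, (fermionTorusGraph 2 L).Adj x y →
      torusStagger x = -torusStagger y := fun x y h => torusStagger_eq_neg_of_adj_holds hL h
  rw [← card_fermionTorus_sq'] at hN hHψ
  -- (`convert`: the two `DecidableEq (FermionTorus 2 L)` instances behind `univ.erase` agree)
  convert offsite_stagger_pair_sum_eq_neg_expect_doubleOcc hG _ hA hcard ht hU _ hε hN hHψ using 3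
  all_goals first | rfl | (ext; simp only [Finset.mem_erase, Finset.mem_univ])

/-- **Row form on the torus**: for every site `x`,
`Σ_{y ≠ x} (-1)^{x+y} ⟨ψ, Δ†_x Δ_y ψ⟩ = -⟨ψ, n_{x↑} n_{x↓} ψ⟩`. [cite: ZhangPRB1990]
[cite: LiebPRL1989, proof of Theorem 2] -/
theorem hubbardTorus_offsite_stagger_pair_sum_eq_neg_doubleOcc (hL : Even L) {t U : ℝ}
    (ht : t ≠ 0) (hU : 0 < U) {ψ : Fock (Orb (FermionTorus 2 L))} (hN : IsNParticle (L ^ 2) ψ)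
    (hHψ : hamiltonian (fermionTorusGraph 2 L) t U *ᵥ ψ =
      ((groundEnergyAt (fermionTorusGraph 2 L) t U (L ^ 2) : ℝ) : ℂ) • ψ) (x : FermionTorus 2 L) :
    ∑ y ∈ univ.erase x, ((torusStagger x : ℤ) : ℂ) * ((torusStagger y : ℤ) : ℂ) *
        expect (creation (orb x 0) * creation (orb x 1) *
          (annihilation (orb y 1) * annihilation (orb y 0))) ψ =
      -expect (numberOp x 0 * numberOp x 1) ψ := by
  obtain ⟨hG, hA, h2, -⟩ := LiebHalfFilled.hubbardTorus_lieb_hypotheses (L := L) hL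
  have hcard := LiebHalfFilled.compl_card_eq_card_of_two_mul h2
  have hε : ∀ x y : FermionTorus 2 L, (fermionTorusGraph 2 L).Adj x y →
      torusStagger x = -torusStagger y := fun x y h => torusStagger_eq_neg_of_adj_holds hL h
  rw [← card_fermionTorus_sq'] at hN hHψ
  convert offsite_stagger_pair_sum_eq_neg_doubleOcc hG _ hA hcard ht hU _ hε hN hHψ x using 2
  all_goals first | rfl | (ext; simp only [Finset.mem_erase, Finset.mem_univ])

/-- `IsGroundState` forms on the torus. [cite: LiebPRL1989, proof of Theorem 2]
[cite: YangZhang1990, Theorem 1] [cite: ZhangPRB1990] -/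
theorem hubbardTorus_eta_mulVec_eq_zero_of_isGroundState (hL : Even L) {t U : ℝ} (ht : t ≠ 0)
    (hU : 0 < U) {ψ : Fock (Orb (FermionTorus 2 L))}
    (hψ : IsGroundState (hamiltonian (fermionTorusGraph 2 L) t U) (L ^ 2) ψ) :
    (etaLower (torusStagger (d := 2) (L := L)) *ᵥ ψ = 0 ∧
        etaRaise (torusStagger (d := 2) (L := L)) *ᵥ ψ = 0) ∧
      ∑ x : FermionTorus 2 L, ∑ y ∈ univ.erase x,
          ((torusStagger x : ℤ) : ℂ) * ((torusStagger y : ℤ) : ℂ) *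
            expect (creation (orb x 0) * creation (orb x 1) *
              (annihilation (orb y 1) * annihilation (orb y 0))) ψ =
        -expect (∑ x : FermionTorus 2 L, numberOp x 0 * numberOp x 1) ψ :=
  ⟨hubbardTorus_eta_mulVec_eq_zero hL ht hU hψ.1 hψ.2.2,
    hubbardTorus_offsite_stagger_pair_sum_eq_neg_expect_doubleOcc hL ht hU hψ.1 hψ.2.2⟩

end Torus

end Literature.MathematicalPhysics.QuantumLattice
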